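import Summits.CriticalPhenomena.Ising3DConformalLimit.Theses.HyperoctahedralRP
import Summits.CriticalPhenomena.Ising3DConformalLimit.Theorems.MoebiusLimitExists.Negative.EtaExists

/-!
# `InversionUpgradeNormalised` (item stmt-CriticalPhenomena-1982): the sharper forced window `Δ ∈ [1/2, 3/4]`

Negative knowledge about the crux
`Summit.CriticalPhenomena.Ising3DConformalLimit.Theses.HyperoctahedralRP.InversionUpgradeNormalised`
(standing crux disprover, cycle 2, D-0016). `Negative/AutomaticOrders.delta_mem_Icc_of_hyp` pins the
scaling dimension of every instance of the hypotheses to `[1/2, 1]` (infrared bound + Simon–Lieb).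
With the `O(3)` invariance contained in (H5), the sibling disprover's theorem
`MoebiusLimitExistsNegative.delta_mem_Icc_of_covariantLimit` (Duminil-Copin–Panis 2025, Thm 1.5:
`η ≤ 1/2`, tree `dcp_isingEta_le_half_holds`, via `hasIsingExponentEta_of_covariantLimit`) sharpens
this to `Δ ∈ [1/2, 3/4]`: the crux is VACUOUS at every `Δ ∉ [1/2, 3/4]`
(`crux_at_of_not_mem_sharpWindow`), and equivalent to its restriction to the sharp window
(`crux_iff_sharpWindow`). Consequence for decoy hunting (Disproof §7'): an RP decoy relevant to
the crux must have `Δ ≤ 3/4`, in particular `Δ = 1` (the `:φ²:`-type end of the window) is out.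

Theorem-only file.
-/

noncomputable section

namespace Summit.CriticalPhenomena.Ising3DConformalLimit.InversionUpgradeNormalisedNegative

open Literature.Probability.LatticeModels
open Summit.CriticalPhenomena.Ising3DConformalLimit.MoebiusLimitExistsNegative (delta_mem_Icc_of_covariantLimit)

/-- **Sharp window.** Every instance of (H1), (H2), (H4), (H5), (H6) has `Δ ∈ [1/2, 3/4]`
(infrared bound below; Duminil-Copin–Panis 2025 Thm 1.5 above, through the `O(3)` invariance in
(H5)). [cite: DuminilCopinPanis2025LowerBounds, Theorem 1.5] -/
theorem delta_mem_sharpWindow_of_hyp {ρ : ℝ → ℝ} {Δ : ℝ} {S : CorrFamily 3}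
    (hρ : ∀ δ ∈ Set.Ioc (0:ℝ) 1, 0 < ρ δ) (hlim : HasPointwiseScalingLimit (criticalCorr 3) ρ S)
    (hnd : IsNondegenerateTwoPoint S) (heuc : IsEuclideanInvariant S) (hsc : IsScaleCovariant Δ S) :
    Δ ∈ Set.Icc (1 / 2 : ℝ) (3 / 4) :=
  delta_mem_Icc_of_covariantLimit hρ hlim hnd heuc.2 hsc

/-- The crux restricted to a scaling dimension OUTSIDE `[1/2, 3/4]` holds vacuously. [folklore] -/
theorem crux_at_of_not_mem_sharpWindow {Δ : ℝ} (hΔ : Δ ∉ Set.Icc (1 / 2 : ℝ) (3 / 4)) :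
    ∀ (ρ : ℝ → ℝ) (S : CorrFamily 3), (∀ δ ∈ Set.Ioc (0:ℝ) 1, 0 < ρ δ) →
      HasPointwiseScalingLimit (criticalCorr 3) ρ S → (∀ n z, z ∉ NonCoincident 3 n → S n z = 0) →
      IsNondegenerateTwoPoint S → IsEuclideanInvariant S → IsScaleCovariant Δ S →
      IsInversionCovariant Δ S :=
  fun _ _ hρ hlim _ hnd heuc hsc => absurd (delta_mem_sharpWindow_of_hyp hρ hlim hnd heuc hsc) hΔ

/-- **WLOG `Δ ∈ [1/2, 3/4]`**: the crux is equivalent to its restriction to the sharp window. [folklore] -/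
theorem crux_iff_sharpWindow :
    Summit.CriticalPhenomena.Ising3DConformalLimit.Theses.HyperoctahedralRP.InversionUpgradeNormalised ↔
      ∀ (ρ : ℝ → ℝ) (Δ : ℝ) (S : CorrFamily 3), Δ ∈ Set.Icc (1 / 2 : ℝ) (3 / 4) →
        (∀ δ ∈ Set.Ioc (0:ℝ) 1, 0 < ρ δ) →
        HasPointwiseScalingLimit (criticalCorr 3) ρ S → (∀ n z, z ∉ NonCoincident 3 n → S n z = 0) →
        IsNondegenerateTwoPoint S → IsEuclideanInvariant S → IsScaleCovariant Δ S →
        IsInversionCovariant Δ S := by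
  constructor
  · intro h ρ Δ S _ h1 h2 h3 h4 h5 h6
    exact h ρ Δ S h1 h2 h3 h4 h5 h6
  · intro h ρ Δ S h1 h2 h3 h4 h5 h6
    exact h ρ Δ S (delta_mem_sharpWindow_of_hyp h1 h2 h4 h5 h6) h1 h2 h3 h4 h5 h6

/-- REFUTED STRENGTHENING-BY-INSTANCE: there is no instance of the hypotheses with `3/4 < Δ`
(e.g. no normalised `O(3)`/scale-covariant Ising₃ limit with `Δ = 1`). [cite: DuminilCopinPanis2025LowerBounds, Theorem 1.5] -/
theorem no_hyp_with_delta_gt_three_quarters {ρ : ℝ → ℝ} {Δ : ℝ} {S : CorrFamily 3}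
    (hρ : ∀ δ ∈ Set.Ioc (0:ℝ) 1, 0 < ρ δ) (hlim : HasPointwiseScalingLimit (criticalCorr 3) ρ S)
    (hnd : IsNondegenerateTwoPoint S) (heuc : IsEuclideanInvariant S) (hsc : IsScaleCovariant Δ S) :
    ¬ (3 / 4 < Δ) :=
  not_lt.2 (delta_mem_sharpWindow_of_hyp hρ hlim hnd heuc hsc).2

end Summit.CriticalPhenomena.Ising3DConformalLimit.InversionUpgradeNormalisedNegative

end
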